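import Summits.ValiantsHypothesis.ValiantsHypothesis.Theorems.DivisionGapZeroOneTransferIMMToSpanDefs

/-!
# Padding lemma for line `arborescence-span` (crux `ZeroOneTransfer`, stmt-ValiantsHypothesis-5066) —
# auxiliary theorems: labelled spanning-tree polynomials are positive projections of `ST_N`

Support file for `stub_immToSpan` (objects in `Theorems/DivisionGapZeroOneTransferIMMToSpanDefs.lean`,
main file `Theorems/DivisionGapZeroOneTransferIMMToSpan.lean`).

* `isArborescence_transportArb_iff`, `stV_eq_aeval`, `isProjection_stV` — transported along
  `V ≃ Fin N`, the labelled spanning-tree polynomial `stV lab` is the substitution `aeval` of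
  Jerrum–Snir's `stPoly R N`; if every label is a variable or a constant it is a positive projection
  (`IsProjection`) of `stPoly R (card V)` (registered sub-goal `stub_immToSpan_stProjection`).
* `stV_eq_sum_of_param` — the comparison principle (`Finset.sum_bij_ne_zero`) used to evaluate `stV`
  by parametrising the arborescences of nonzero weight; `stV_of_isEmpty`.
* `prod_ite_eq_mul_pow`; `card_VN_le` — the size bound `#VN ≤ 4 (#ι + d + 1)^8`.
* `labH_prog_ne_zero`, `labH_relay_ne_zero` (the arcs of nonzero label), `sum_labH_prog` (uniform
  out-label `W` of the program nodes `≠ (d, t)`), `wt_ext`, `sum_labA_prog`.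

All statements are over an arbitrary commutative semiring. [folklore]
-/

noncomputable section

namespace Summit.ValiantsHypothesis.ValiantsHypothesis.Theorems.DivisionGapZeroOneTransfer

-- the single-problem summit's namespace `Summit.ValiantsHypothesis.ValiantsHypothesis` repeats
set_option linter.dupNamespace false

namespace IMMToSpan

open Literature.Computability.AlgebraicComplexity Literature.Barriers.ValiantsHypothesis
open MvPolynomial Finset
open Summit.ValiantsHypothesis.ValiantsHypothesis.Theorems.ZeroOneTransfer.Negative
  (isArborescence_iff_exists_rank)

/-! ### Spanning-tree polynomials on a finite vertex type are projections of `ST_N` -/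

section General

variable {V : Type} {R : Type} [CommSemiring R]

/-- A parent map of nonzero weight uses only arcs of nonzero label. [folklore] -/
theorem label_ne_zero_of_wt_ne_zero [Fintype V] {lab : V → Option V → R} {T : V → Option V}
    (h : wt lab T ≠ 0) (v : V) : lab v (T v) ≠ 0 :=
  fun hv => h (Finset.prod_eq_zero (Finset.mem_univ v) hv)

/-- Transport preserves arborescences (ranks are carried along the bijection). [folklore] -/
theorem isArborescence_transportArb_iff [Fintype V] [DecidableEq V] {N : ℕ} (e : V ≃ Fin N)
    (T : V → Option V) : IsArborescence (transportArb e T) ↔ T ∈ arbsV V := by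
  rw [isArborescence_iff_exists_rank, mem_arbsV]
  constructor
  · rintro ⟨rk, hrk⟩
    refine ⟨fun v => rk (e v), fun v w hvw => hrk (e v) (e w) ?_⟩
    rw [transportArb_apply, Equiv.symm_apply_apply, hvw]
    rfl
  · rintro ⟨rk, hrk⟩
    refine ⟨fun i => rk (e.symm i), fun i j hij => ?_⟩
    rw [transportArb_apply, Option.map_eq_some_iff] at hij
    obtain ⟨w, hw, rfl⟩ := hij
    dsimp only
    rw [Equiv.symm_apply_apply]
    exact hrk _ _ hw

/-- **`stV` is a substitution instance of `ST_N`**: along `e : V ≃ Fin N`,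
`stV lab = ST_N (x_{(i, j)} ↦ lab (e⁻¹ i) (e⁻¹ j))`. [folklore] -/
theorem stV_eq_aeval [Fintype V] [DecidableEq V] {τ : Type} (lab : V → Option V → MvPolynomial τ R)
    {N : ℕ} (e : V ≃ Fin N) :
    stV lab = aeval (fun p : Fin N × Option (Fin N) => lab (e.symm p.1) (p.2.map e.symm))
      (stPoly R N) := by
  classical
  unfold stPoly stV
  rw [map_sum]
  simp_rw [map_prod, aeval_X]
  refine Finset.sum_equiv (transportArb e) (fun T => ?_) (fun T _ => ?_)
  · rw [Finset.mem_filter, isArborescence_transportArb_iff]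
    simp
  · unfold wt
    rw [← Equiv.prod_comp e.symm]
    refine Fintype.prod_congr _ _ fun i => ?_
    rw [transportArb_apply, Option.map_map, Equiv.symm_comp_self, Option.map_id, id_eq]

/-- **A labelled spanning-tree polynomial whose labels are variables or constants is a positive
projection of `ST_{#V}`.** [folklore] -/
theorem isProjection_stV [Fintype V] [DecidableEq V] {τ : Type}
    (lab : V → Option V → MvPolynomial τ R)
    (hlab : ∀ v o, (∃ x, lab v o = X x) ∨ ∃ a, lab v o = C a) :
    IsProjection (stV lab) (stPoly R (Fintype.card V)) :=
  ⟨fun p => lab ((Fintype.equivFin V).symm p.1) (p.2.map (Fintype.equivFin V).symm),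
    fun _ => hlab _ _, stV_eq_aeval lab (Fintype.equivFin V)⟩

/-- `0` is a label (a variable or a constant). [folklore] -/
theorem isLabel_zero {τ : Type} :
    (∃ x, (0 : MvPolynomial τ R) = X x) ∨ ∃ a, (0 : MvPolynomial τ R) = C a :=
  Or.inr ⟨0, by simp⟩

/-- `1` is a label (a variable or a constant). [folklore] -/
theorem isLabel_one {τ : Type} :
    (∃ x, (1 : MvPolynomial τ R) = X x) ∨ ∃ a, (1 : MvPolynomial τ R) = C a :=
  Or.inr ⟨1, by simp⟩

/-- `if c then p else q` is a label if `p` and `q` are (the `Decidable` instance is an implicit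
argument, so that it is unified rather than synthesised). [folklore] -/
theorem isLabel_ite {τ : Type} {c : Prop} {_ : Decidable c} {p q : MvPolynomial τ R}
    (hp : (∃ x, p = X x) ∨ ∃ a, p = C a) (hq : (∃ x, q = X x) ∨ ∃ a, q = C a) :
    (∃ x, (if c then p else q) = X x) ∨ ∃ a, (if c then p else q) = C a := by
  split_ifs <;> assumption

/-- On an empty vertex type the spanning-tree polynomial is `1` (the empty arborescence). [folklore] -/
theorem stV_of_isEmpty [Fintype V] [DecidableEq V] [IsEmpty V] (lab : V → Option V → R) :
    stV lab = 1 := by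
  unfold stV
  have h1 : arbsV V = univ := by
    ext T
    simp only [mem_arbsV, Finset.mem_univ, iff_true]
    exact ⟨fun _ => 0, fun v => isEmptyElim v⟩
  rw [h1]
  have : Unique (V → Option V) := Pi.uniqueOfIsEmpty _
  rw [Finset.univ_unique, Finset.sum_singleton]
  unfold wt
  exact Fintype.prod_empty _

/-- **Comparison principle**: the arborescence sum `stV lab` equals `Σ_{a ∈ S} wt (ext a)` as soon as
`ext` is injective on `S`, sends parameters of nonzero weight to arborescences, and reaches every
arborescence of nonzero weight (`Finset.sum_bij_ne_zero`). [folklore] -/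
theorem stV_eq_sum_of_param [Fintype V] [DecidableEq V] {α : Type} (lab : V → Option V → R)
    (S : Finset α) (ext : α → (V → Option V))
    (harb : ∀ a ∈ S, wt lab (ext a) ≠ 0 → ext a ∈ arbsV V)
    (hinj : ∀ a ∈ S, ∀ b ∈ S, ext a = ext b → a = b)
    (hsurj : ∀ T ∈ arbsV V, wt lab T ≠ 0 → ∃ a ∈ S, ext a = T) :
    stV lab = ∑ a ∈ S, wt lab (ext a) := by
  unfold stV
  symm
  refine Finset.sum_bij_ne_zero (fun a _ _ => ext a) (fun a ha hne => harb a ha hne)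
    (fun a ha _ b hb _ h => hinj a ha b hb h) (fun T hT hne => ?_) (fun _ _ _ => rfl)
  obtain ⟨a, ha, rfl⟩ := hsurj T hT hne
  exact ⟨a, ha, hne, rfl⟩

end General

section Paths

variable {R : Type} [CommSemiring R] {ι : Type} [Fintype ι] [DecidableEq ι]

/-- `Π_i (if i = a then f i else w) = f a · w ^ (#ι - 1)`. [folklore] -/
theorem prod_ite_eq_mul_pow (a : ι) (f : ι → R) (w : R) :
    ∏ i, (if i = a then f i else w) = f a * w ^ (Fintype.card ι - 1) := by
  rw [← Finset.mul_prod_erase univ _ (Finset.mem_univ a), if_pos rfl]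
  congr 1
  rw [Finset.prod_congr rfl fun i hi => if_neg (Finset.ne_of_mem_erase hi), Finset.prod_const,
    Finset.card_erase_of_mem (Finset.mem_univ a), Finset.card_univ]

end Paths

/-! ### Size bound, legal arcs and out-labels of the padded digraph -/

section Graph

variable {ι : Type} {d : ℕ}

/-- The size bound of the stub: `#VN ≤ 4 (#ι + d + 1)^8`. [folklore] -/
theorem card_VN_le (ι : Type) [Fintype ι] (d : ℕ) :
    Fintype.card (VN ι d) ≤ 4 * (Fintype.card ι + d + 1) ^ 8 := by
  rw [card_VN]
  set n := Fintype.card ι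
  set m := n + d + 1 with hm
  have h1 : d + 1 ≤ m := by omega
  have h2 : n ≤ m := by omega
  have h3 : d * n * n ≤ m ^ 3 := by
    calc d * n * n ≤ m * m * m := Nat.mul_le_mul (Nat.mul_le_mul (by omega) h2) h2
      _ = m ^ 3 := by ring
  have h4 : 1 ≤ m ^ 3 := Nat.one_le_pow _ _ (by omega)
  have h5 : m ^ 5 ≤ m ^ 8 := Nat.pow_le_pow_right (by omega) (by norm_num)
  calc (d + 1) * n * (d * n * n + 2) ≤ m * m * (3 * m ^ 3) :=
        Nat.mul_le_mul (Nat.mul_le_mul h1 h2) (by omega)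
    _ = 3 * m ^ 5 := by ring
    _ ≤ 4 * (n + d + 1) ^ 8 := by rw [← hm]; omega

variable [DecidableEq ι] {R : Type} [CommSemiring R] (M : Fin d → Matrix ι ι R)

/-- The arcs of nonzero label out of a program node. [folklore] -/
theorem labH_prog_ne_zero {s t : ι} {u : PN ι d} {o : Option (VN ι d)}
    (h : labH M s t (.prog u) o ≠ 0) :
    (∃ o', o = some (.relay (u, o'))) ∨ (o = none ∧ u = (Fin.last d, t)) := by
  rcases o with _ | (u' | r)
  · right
    refine ⟨rfl, ?_⟩
    by_contra hu
    exact h (by simp [labH, hu])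
  · exact absurd (by simp [labH]) h
  · left
    by_cases hr : r.1 = u
    · exact ⟨r.2, by rw [← hr]⟩
    · exact absurd (by simp [labH, hr]) h

/-- The arc of nonzero label out of a relay. [folklore] -/
theorem labH_relay_ne_zero {s t : ι} {r : PN ι d × Option (EN ι d)} {o : Option (VN ι d)}
    (h : labH M s t (.relay r) o ≠ 0) : o = some (.prog (relayTgt s r)) := by
  rcases o with _ | w
  · exact absurd (by simp [labH]) h
  · by_cases hw : w = .prog (relayTgt s r)
    · rw [hw]
    · exact absurd (by simp [labH, hw]) h

variable [Fintype ι]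

/-- The relays of a program node carry total label `W`. [folklore] -/
theorem sum_relay_lab (u : PN ι d) :
    ∑ r : PN ι d × Option (EN ι d), (if r.1 = u then lab₀ M r.2 else 0) = W M := by
  rw [Fintype.sum_prod_type, Finset.sum_comm]
  simp only [Finset.sum_ite_eq', Finset.mem_univ, if_true]
  rfl

/-- **Uniform out-weight**: every program node other than `(d, t)` has total out-label `W`.
[folklore] -/
theorem sum_labH_prog (s t : ι) (u : PN ι d) (hu : u ≠ (Fin.last d, t)) :
    ∑ o, labH M s t (.prog u) o = W M := by
  rw [Fintype.sum_option, sum_VN]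
  simp only [labH, if_neg hu, Finset.sum_const_zero, zero_add]
  exact sum_relay_lab M u

/-- The weight of `ext c`: only the program nodes contribute. [folklore] -/
theorem wt_ext (s t : ι) (c : PN ι d → Option (VN ι d)) :
    wt (labH M s t) (ext s c) = ∏ u, labH M s t (.prog u) (c u) := by
  unfold wt
  rw [prod_VN]
  have h1 : ∀ r, labH M s t (.relay r) (ext s c (.relay r)) = 1 := fun r => by simp [ext, labH]
  simp only [h1, Finset.prod_const_one, mul_one]
  rfl

/-- Out-weights of the bouquet. [folklore] -/
theorem sum_labA_prog (i₀ : ι) (u : PN ι d) :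
    ∑ o, labA M i₀ (.prog u) o = if u.2 = i₀ then 1 else W M := by
  rw [Fintype.sum_option, sum_VN]
  by_cases h : u.2 = i₀
  · simp [labA, h]
  · simp only [labA, h, if_false, Finset.sum_const_zero, zero_add, ne_eq, not_false_eq_true,
      and_true]
    exact sum_relay_lab M u

end Graph

end IMMToSpan

/-! ### Registered sub-goal -/

/-- **A labelled spanning-tree polynomial whose labels are variables or constants is a positive
projection of `ST_{#V}`** (registered sub-goal `stub_immToSpan_stProjection` of `stub_immToSpan`).
[folklore] -/
theorem stub_immToSpan_stProjection :
    ∀ (V R τ : Type) [CommSemiring R] [Fintype V] [DecidableEq V]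
      (lab : V → Option V → MvPolynomial τ R),
      (∀ v o, (∃ x, lab v o = MvPolynomial.X x) ∨ ∃ a, lab v o = MvPolynomial.C a) →
      Literature.Computability.AlgebraicComplexity.IsProjection
        (Summit.ValiantsHypothesis.ValiantsHypothesis.Theorems.DivisionGapZeroOneTransfer.IMMToSpan.stV
          lab) (Literature.Barriers.ValiantsHypothesis.stPoly R (Fintype.card V)) :=
  fun _ _ _ _ _ _ lab hlab => IMMToSpan.isProjection_stV lab hlab

end Summit.ValiantsHypothesis.ValiantsHypothesis.Theorems.DivisionGapZeroOneTransfer
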